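import Literature.NumberTheory.EllipticCurves.TianYuanZhang2017.RhoIndexTorsionClasses
import Literature.NumberTheory.EllipticCurves.CongruentNumberEvenMonskySelmerExact
import HarnessLib

/-!
# Tian–Yuan–Zhang's `ρ(n)` read off the kernel of Monsky's matrix — even `n` (file 3 of 3)

`n = 2p₁⋯p_k` with distinct odd primes, `E_n : y² = x³ − n²x`, `2^{ρ(n)} = [E_n(ℚ) : φ_n(A_n(ℚ)) + E_n[2]]`
(tree `(rhoSubgroup n).index`, Tian–Yuan–Zhang 2017 §1), and Monsky's EVEN matrix
`M = ( Aᵀ + D₂  D₋₁ ; D₂  A + D₂ )` with `#Sel⁽²⁾(E_n/ℚ) = 2^{2+s(n)}`, `2^{s(n)} = #ker M`, the kernel vectors being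
`(β; α)` with `βᵢ = v_{pᵢ}(b)`, `αᵢ = v_{pᵢ}(a) (mod 2)` for the normalised components `[a]` (`x + n`), `[b]` (`x`)
of a Selmer class (appendix to Heath-Brown 1994, "a sketch proof" in print; BOTH halves are theorems of the tree,
`CongruentNumberEvenMonskySelmer{Bound,Exact}.lean`). THIS FILE PROVES (theorems only):

* `rhoIndex_eq_one_of_monskyKernel_even` — **if every kernel vector `(β; α)` of `M` has `β = 0`, then
  `ρ(n) = 0`**; `rhoIndex_eq_one_of_ker_pair_even` — the `s(n) = 1` form. NO rank hypothesis; this is the first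
  door to `ρ = 0` for EVEN `n` in the tree (Faulkner–James' bound is for odd `n ≡ ±1 (mod 8)`).

Argument: subtracting the torsion pair with the same value of the normalising character `ν = (v₂(b), χ₄(b))` (the
pairs `(n, −n²)`, `(2n, n)`, `(2n², −n)` of `T₂, T₃, T₁` take the values `(0,1)`, `(1, χ₄(n/2))`,
`(1, 1 + χ₄(n/2))`) normalises a Selmer class; its coordinates lie in `ker M` (tree
`monskyMatrixEven_mulVec_eq_zero`), so `β = 0` makes every `v_{pᵢ}(b)` even; `v₂(b)` is even, the valuations off
`2p₁⋯p_k` are even, and `sign b = χ₄(b) − Σ [(−1/pⱼ) = −1] v_{pⱼ}(b) = 0` (tree `chi4_expand`), so `b` is a square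
and the original `b`-class is a torsion class; file 1 (`RhoIndexTorsionClasses.lean`) concludes `ρ(n) = 0`.
Census (cell `bsd-print-cf2`, seat p2, kit job j282439 + matrix count): among square-free `n ≡ 6 (mod 8)`,
`n ≤ 3·10⁴`, with `s(n) = 1`, the hypothesis holds for few `n` (first `n = 870`); for `k ≤ 2` never — there
`ρ(n) = 1` whenever `rank E_n(ℚ) = 1` (e.g. `n = 6, 14, 30`: generators `(−3, 9)`, `(18, 48)`, `(−6, 72)`).

## References

* [TianYuanZhang2017] Y. Tian, X. Yuan, S.-W. Zhang, *Genus periods, genus points and congruent number problem*,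
  Asian J. Math. 21 (2017) 721–774 = arXiv:1411.4728, §1 (definition of `ρ(n)`, chunk p0002 L101–L110),
  Thm. 1.2 (journal Thm. 1.4).
* [HeathBrown1994SelmerCongruentII] D. R. Heath-Brown, *The size of Selmer groups for the congruent number
  problem, II*, with an appendix by P. Monsky, Invent. Math. 118 (1994) 331–370: Appendix, typescript
  p. 38 L17 – p. 39 L33 (odd `D`), p. 40 L40 – p. 41 L36 (even `D`).
* [SilvermanAEC2009] J. H. Silverman, *The Arithmetic of Elliptic Curves*, 2nd ed., GTM 106, Thm. X.1.1,
  Prop. X.1.4, Prop. X.4.9.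
* [FaulknerJames2007] B. Faulkner, K. James, Ramanujan J. 14 (2007) 107–129, Thm. 1.2 (2) (the `φ̂`-side bound,
  tree `RhoIndexEvenPartitionBound.lean`, for comparison).
-/

noncomputable section

open scoped Classical

open WeierstrassCurve WeierstrassCurve.Affine WeierstrassCurve.Affine.Point
open Literature.NumberTheory.GaloisRepresentations
open Literature.NumberTheory.EllipticCurves.KramerTwoDescent
open Literature.NumberTheory.EllipticCurves.TwoDescentLocal
open Literature.NumberTheory.EllipticCurves.HeathBrown1994
open Literature.NumberTheory.EllipticCurves.TianYuanZhang2017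
open Literature.NumberTheory.EllipticCurves.FaulknerJames2007
open IsDedekindDomain NumberField Matrix

namespace Literature.NumberTheory.EllipticCurves.TianYuanZhang2017

namespace RhoMonskyKernel

/-- The two values of a bit. [folklore] -/
private theorem zmod2_cases (x : ZMod 2) : x = 0 ∨ x = 1 := by revert x; decide

/-- `2 = 0` in `ℤ/2`. [folklore] -/
private theorem two_eq_zero_zmod2 : (2 : ZMod 2) = 0 := by decide

/-- In `ℤ/2`, two different bits differ by `1`. [folklore] -/
private theorem zmod2_eq_add_one_of_ne {x y : ZMod 2} (h : x ≠ y) : x = y + 1 := by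
  revert x y; decide

/-- `1 + 1 = 0` in `ℤ/2`. [folklore] -/
private theorem one_add_one_zmod2 : (1 : ZMod 2) + 1 = 0 := by decide

/-- `v₂(−1) ≡ 0`. [folklore] -/
private theorem parityBit_two_neg_one : parityBit 2 (-1 : ℚ) = 0 := by
  unfold parityBit; rw [padicValRat.neg, padicValRat.one]; rfl

/-- In `ℚ^×/ℚ^{×2}` every class is its own inverse. [folklore] -/
private theorem sqUnits_inv_eq_self (u : SqUnits ℚ) : u⁻¹ = u := by
  rw [inv_eq_iff_mul_eq_one, SqUnits.mul_self]

/-! ### §2. Even `n = 2p₁⋯p_k`: Monsky's matrix `( Aᵀ + D₂  D₋₁ ; D₂  A + D₂ )` -/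

section Even

open Literature.NumberTheory.EllipticCurves.CongruentNumberEvenMonskySelmer

variable {k : ℕ} {p : Fin k → ℕ}

/-- `2 ∏ pᵢ ≠ 0`. [folklore] -/
private theorem two_n_ne_zero (hp : ∀ i, (p i).Prime) : 2 * ∏ i, p i ≠ 0 :=
  mul_ne_zero two_ne_zero (Finset.prod_ne_zero_iff.mpr fun i _ => (hp i).ne_zero)

section Selmer

variable [hE : (congruentNumberCurve (2 * ∏ i, p i)).IsElliptic]
variable (hT : (congruentNumberCurve (2 * ∏ i, p i)).toAffine.SplitTwoTorsion
  (-((2 * ∏ i, p i : ℕ) : ℚ)) 0 ((2 * ∏ i, p i : ℕ) : ℚ))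

/-- **The `b`-component of a NORMALISED Selmer class of `E_{2p₁⋯p_k}` is a square** when every kernel vector
`(β; α)` of Monsky's even matrix has `β = 0`: the coordinates `(v_{pᵢ}(b); v_{pᵢ}(a))` of the class lie in
`ker M` (`monskyMatrixEven_mulVec_eq_zero`), so all `v_{pᵢ}(b)` are even; `v₂(b)` is even (normalisation), the
valuations off `2p₁⋯p_k` are even, and `sign b = χ₄(b) − Σ [(−1/pⱼ) = −1] v_{pⱼ}(b) = 0`.
[cite: HeathBrown1994SelmerCongruentII, Appendix (Monsky), typescript p. 41 L1–L36]
[cite: SilvermanAEC2009, Prop. X.1.4, Example X.1.5, Prop. X.4.9] -/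
theorem sqClass_eq_one_of_normalised_even (hp : ∀ i, (p i).Prime) (hp2 : ∀ i, p i ≠ 2)
    (hinj : Function.Injective p)
    (hker : ∀ x y : Fin k → ZMod 2, monskyMatrixEven p *ᵥ Sum.elim x y = 0 → x = 0)
    {c : galH1Torsion (congruentNumberCurve (2 * ∏ i, p i)) 2}
    (hc : c ∈ (congruentNumberCurve (2 * ∏ i, p i)).selmerGroup 2) (a b : ℚˣ)
    (ha : kummerEquiv ℚ 2 ((congruentNumberCurve (2 * ∏ i, p i)).twoTorsionCharH1 hT c) =
      Additive.ofMul (QuotientGroup.mk a))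
    (hb : kummerEquiv ℚ 2 ((congruentNumberCurve (2 * ∏ i, p i)).twoTorsionCharH1 hT.swap₁₂ c) =
      Additive.ofMul (QuotientGroup.mk b))
    (hb2 : parityBit 2 (b : ℚ) = 0) (hb4 : chi4 (b : ℚ) = 0) : sqClass (b : ℚ) = 1 := by
  haveI : Fact (Nat.Prime 2) := ⟨Nat.prime_two⟩
  have hb0 : (b : ℚ) ≠ 0 := b.ne_zero
  have hM := monskyMatrixEven_mulVec_eq_zero hT hp hp2 hinj hc a b ha hb hb2 hb4
  have hβ : ∀ i, parityBit (p i) (b : ℚ) = 0 := fun i => by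
    have := congrFun (hker _ _ hM) i
    simpa using this
  have hev : ∀ r : ℕ, r.Prime → r ≠ 2 → (∀ j, p j ≠ r) → Even (padicValRat r (b : ℚ)) :=
    fun r hr hr2 hrp => (even_padicValRat_of_mem hT hp hinj hc a b ha hb hr hr2 hrp).2
  have C4 := chi4_expand hp hp2 hinj hb0 hev
  rw [hb4, Finset.sum_eq_zero (fun j _ => by rw [hβ j, mul_zero]), add_zero] at C4
  have hbpos : 0 < (b : ℚ) := (signBit_eq_zero_iff hb0).mp C4.symm
  refine sqClass_eq_one_of_forall hb0 hbpos fun r hr => ?_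
  by_cases hr2 : r = 2
  · subst hr2; exact parityBit_eq_zero_iff.mp hb2
  by_cases hrp : ∃ j, p j = r
  · obtain ⟨j, rfl⟩ := hrp
    exact parityBit_eq_zero_iff.mp (hβ j)
  · exact hev r hr hr2 fun j h => hrp ⟨j, h⟩

/-- **The `b`-component of EVERY Selmer class of `E_{2p₁⋯p_k}` lies in `{1, [−1], [n], [−n]}`** when every kernel
vector `(β; α)` of Monsky's even matrix has `β = 0`: subtract the class of the torsion pair with the same value of
the normalising character `ν = (v₂(b), χ₄(b))` (the pairs `(n, −n²)`, `(2n, n)`, `(2n², −n)` take the values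
`(0, 1)`, `(1, χ₄(n/2))`, `(1, 1 + χ₄(n/2))`) and apply `sqClass_eq_one_of_normalised_even`.
[cite: HeathBrown1994SelmerCongruentII, Appendix (Monsky), typescript p. 41 L1–L36]
[cite: SilvermanAEC2009, Prop. X.1.4, Example X.1.5, Prop. X.4.9] -/
theorem inTorsionClasses_of_mem_selmer_even (hp : ∀ i, (p i).Prime) (hp2 : ∀ i, p i ≠ 2)
    (hinj : Function.Injective p)
    (hker : ∀ x y : Fin k → ZMod 2, monskyMatrixEven p *ᵥ Sum.elim x y = 0 → x = 0)
    {c : galH1Torsion (congruentNumberCurve (2 * ∏ i, p i)) 2}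
    (hc : c ∈ (congruentNumberCurve (2 * ∏ i, p i)).selmerGroup 2) (b : ℚˣ)
    (hb : kummerEquiv ℚ 2 ((congruentNumberCurve (2 * ∏ i, p i)).twoTorsionCharH1 hT.swap₁₂ c) =
      Additive.ofMul (QuotientGroup.mk b)) :
    (sqClass (b : ℚ) = 1 ∨ sqClass (b : ℚ) = sqClass (-1 : ℚ) ∨ sqClass (b : ℚ) = sqClass ((2 * ∏ i, p i : ℕ) : ℚ) ∨ sqClass (b : ℚ) = sqClass (-((2 * ∏ i, p i : ℕ) : ℚ))) := by
  haveI : Fact (Nat.Prime 2) := ⟨Nat.prime_two⟩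
  have hn := two_n_ne_zero hp
  set N : ℚ := ((2 * ∏ i, p i : ℕ) : ℚ) with hN
  have hN0 : N ≠ 0 := by rw [hN]; exact_mod_cast hn
  have hNpos : 0 < N := by rw [hN]; exact_mod_cast Nat.pos_of_ne_zero hn
  -- `v₂(n) ≡ 1`, `χ₄(n) = Σ [(−1/pⱼ) = −1]`
  have v2N : parityBit 2 N = 1 := by
    unfold parityBit
    have hprod0 : (∏ j, (p j : ℚ)) ≠ 0 :=
      Finset.prod_ne_zero_iff.mpr fun j _ => Nat.cast_ne_zero.mpr (hp j).ne_zero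
    have h2 : padicValRat 2 (2 : ℚ) = 1 := by simpa using padicValRat.self (p := 2) one_lt_two
    have hodd : padicValRat 2 (∏ j, (p j : ℚ)) = 0 := by
      rw [← Finset.prod_image (s := Finset.univ) (g := p) (f := fun q : ℕ => (q : ℚ)) fun i _ j _ h => hinj h,
        padicValRat_prod_primes (fun q hq => by obtain ⟨j, -, rfl⟩ := Finset.mem_image.mp hq; exact hp j),
        if_neg (fun h2m => by obtain ⟨j, -, hj⟩ := Finset.mem_image.mp h2m; exact hp2 j hj)]
    rw [hN, show ((2 * ∏ j, p j : ℕ) : ℚ) = 2 * ∏ j, (p j : ℚ) by push_cast; rfl,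
      padicValRat.mul two_ne_zero hprod0, h2, hodd]; rfl
  have c4N : chi4 N = ∑ j, addLegendreSym (-1) (p j) := by
    rw [hN, show ((2 * ∏ j, p j : ℕ) : ℚ) = (2 : ℚ) ^ (1 : ℤ) * (((∏ j, (p j : ℤ) : ℤ)) : ℚ) by push_cast; ring,
      chi4_two_zpow_mul, chi4_prod hp hp2]
  -- a representative `a` of the first component
  obtain ⟨a, ha⟩ : ∃ a : ℚˣ, kummerEquiv ℚ 2 ((congruentNumberCurve (2 * ∏ i, p i)).twoTorsionCharH1 hT c) =
      Additive.ofMul (QuotientGroup.mk a) := by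
    obtain ⟨a, ha⟩ := QuotientGroup.mk_surjective
      (Additive.toMul (kummerEquiv ℚ 2 ((congruentNumberCurve (2 * ∏ i, p i)).twoTorsionCharH1 hT c)))
    exact ⟨a, by rw [ha]; rfl⟩
  -- subtracting a torsion pair with the same `ν`-value
  have key : ∀ (aT bT : ℚˣ), (congruentNumberCurve (2 * ∏ i, p i)).twoDescentClass hT aT bT ∈
        (congruentNumberCurve (2 * ∏ i, p i)).selmerGroup 2 →
      parityBit 2 (bT : ℚ) = parityBit 2 (b : ℚ) → chi4 (bT : ℚ) = chi4 (b : ℚ) →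
      (sqClass (bT : ℚ) = 1 ∨ sqClass (bT : ℚ) = sqClass (-1 : ℚ) ∨ sqClass (bT : ℚ) = sqClass (N) ∨ sqClass (bT : ℚ) = sqClass (-N)) → (sqClass (b : ℚ) = 1 ∨ sqClass (b : ℚ) = sqClass (-1 : ℚ) ∨ sqClass (b : ℚ) = sqClass (N) ∨ sqClass (b : ℚ) = sqClass (-N)) := by
    intro aT bT hmem h2 h4 hbt
    have hc' : c - (congruentNumberCurve (2 * ∏ i, p i)).twoDescentClass hT aT bT ∈
        (congruentNumberCurve (2 * ∏ i, p i)).selmerGroup 2 :=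
      ((congruentNumberCurve (2 * ∏ i, p i)).selmerGroup 2).sub_mem hc hmem
    have ha' : kummerEquiv ℚ 2 ((congruentNumberCurve (2 * ∏ i, p i)).twoTorsionCharH1 hT
        (c - (congruentNumberCurve (2 * ∏ i, p i)).twoDescentClass hT aT bT)) =
        Additive.ofMul (QuotientGroup.mk (a * aT)) := by
      rw [map_sub, map_sub, ha, (congruentNumberCurve (2 * ∏ i, p i)).kummerEquiv_twoTorsionCharH1_twoDescentClass hT aT bT,
        ← ofMul_div, QuotientGroup.mk_mul, div_eq_mul_inv, sqUnits_inv_eq_self]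
    have hb' : kummerEquiv ℚ 2 ((congruentNumberCurve (2 * ∏ i, p i)).twoTorsionCharH1 hT.swap₁₂
        (c - (congruentNumberCurve (2 * ∏ i, p i)).twoDescentClass hT aT bT)) =
        Additive.ofMul (QuotientGroup.mk (b * bT)) := by
      rw [map_sub, map_sub, hb,
        (congruentNumberCurve (2 * ∏ i, p i)).kummerEquiv_twoTorsionCharH1_swap_twoDescentClass hT aT bT,
        ← ofMul_div, QuotientGroup.mk_mul, div_eq_mul_inv, sqUnits_inv_eq_self]
    have hb2 : parityBit 2 ((b * bT : ℚˣ) : ℚ) = 0 := by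
      rw [Units.val_mul, parityBit_mul b.ne_zero bT.ne_zero, h2, ← two_mul, two_eq_zero_zmod2, zero_mul]
    have hb4 : chi4 ((b * bT : ℚˣ) : ℚ) = 0 := by
      rw [Units.val_mul, chi4_mul b.ne_zero bT.ne_zero, h4, ← two_mul, two_eq_zero_zmod2, zero_mul]
    have hnorm := sqClass_eq_one_of_normalised_even hT hp hp2 hinj hker hc' (a * aT) (b * bT) ha' hb' hb2 hb4
    rw [Units.val_mul, sqClass_mul b.ne_zero bT.ne_zero] at hnorm
    have hbb : sqClass (b : ℚ) = (sqClass (b : ℚ) * sqClass (bT : ℚ)) * sqClass (bT : ℚ) := by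
      rw [mul_assoc, SqUnits.mul_self, mul_one]
    rw [hbb, hnorm, one_mul]
    exact hbt
  rcases zmod2_cases (parityBit 2 (b : ℚ)) with h2b | h2b
  · rcases zmod2_cases (chi4 (b : ℚ)) with h4b | h4b
    · -- `(0, 0)`: already normalised
      have hnorm := sqClass_eq_one_of_normalised_even hT hp hp2 hinj hker hc a b ha hb h2b h4b
      exact Or.inl hnorm
    · -- `(0, 1)`: `T₂ = (0, 0)`, pair `(n, −n²)`
      have hb0 : ((0 : ℚ) - -N) * (0 - N) ≠ 0 := by
        rw [show ((0 : ℚ) - -N) * (0 - N) = -(N * N) by ring]; exact neg_ne_zero.mpr (mul_ne_zero hN0 hN0)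
      refine key (Units.mk0 ((0 : ℚ) - -N) (by rw [sub_neg_eq_add, zero_add]; exact hN0)) (Units.mk0 _ hb0)
        (twoDescentClass_mem_selmerGroup_T₂ (congruentNumberCurve (2 * ∏ i, p i)) hT _ _ rfl rfl) ?_ ?_ ?_
      · rw [Units.val_mk0, show ((0 : ℚ) - -N) * (0 - N) = -1 * (N * N) by ring,
          parityBit_mul (by norm_num) (mul_ne_zero hN0 hN0), parityBit_mul hN0 hN0, parityBit_two_neg_one, v2N,
          h2b, zero_add, one_add_one_zmod2]
      · rw [Units.val_mk0, show ((0 : ℚ) - -N) * (0 - N) = -1 * (N * N) by ring,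
          chi4_mul (by norm_num) (mul_ne_zero hN0 hN0), chi4_mul_self, chi4_neg_one, h4b, add_zero]
      · right; left
        rw [Units.val_mk0, show ((0 : ℚ) - -N) * (0 - N) = (-1) * (N * N) by ring,
          sqClass_mul (by norm_num) (mul_ne_zero hN0 hN0), sqClass_mul_self, mul_one]
  · by_cases h4b : chi4 (b : ℚ) = ∑ j, addLegendreSym (-1) (p j)
    · -- `(1, χ₄(n))`: `T₃ = (n, 0)`, pair `(2n, n)`
      refine key (Units.mk0 (N - -N) (by rw [show N - -N = 2 * N by ring]; exact mul_ne_zero two_ne_zero hN0))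
        (Units.mk0 (N - 0) (by rw [sub_zero]; exact hN0))
        (twoDescentClass_mem_selmerGroup_T₃ (congruentNumberCurve (2 * ∏ i, p i)) hT _ _ rfl rfl) ?_ ?_ ?_
      · rw [Units.val_mk0, sub_zero, v2N, h2b]
      · rw [Units.val_mk0, sub_zero, c4N, h4b]
      · right; right; left; rw [Units.val_mk0, sub_zero]
    · -- `(1, 1 + χ₄(n))`: `T₁ = (−n, 0)`, pair `(2n², −n)`
      have h4b' := zmod2_eq_add_one_of_ne h4b
      refine key (Units.mk0 ((-N - 0) * (-N - N)) (by
          rw [show (-N - 0) * (-N - N) = 2 * (N * N) by ring]; exact mul_ne_zero two_ne_zero (mul_ne_zero hN0 hN0)))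
        (Units.mk0 (-N - 0) (by rw [sub_zero]; exact neg_ne_zero.mpr hN0))
        (twoDescentClass_mem_selmerGroup_T₁ (congruentNumberCurve (2 * ∏ i, p i)) hT _ _ rfl rfl) ?_ ?_ ?_
      · rw [Units.val_mk0, show (-N - 0 : ℚ) = -1 * N by ring, parityBit_mul (by norm_num) hN0,
          parityBit_two_neg_one, v2N, zero_add, h2b]
      · rw [Units.val_mk0, show (-N - 0 : ℚ) = -1 * N by ring, chi4_mul (by norm_num) hN0, chi4_neg_one, c4N,
          h4b', add_comm]
      · right; right; right; rw [Units.val_mk0, sub_zero]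

end Selmer

/-- **`ρ(n) = 0` read off Monsky's kernel (even `n`).** Let `n = 2p₁⋯p_k` with distinct odd primes and let
`M = ( Aᵀ + D₂  D₋₁ ; D₂  A + D₂ )` be Monsky's matrix (`#Sel⁽²⁾(E_n/ℚ) = 2^{2+s(n)}`, `2^{s(n)} = #ker M`, the
kernel vectors being `(β; α)` with `βᵢ = [pᵢ ∣ b]`, `αᵢ = [pᵢ ∣ a]`). If every kernel vector of `M` has `β = 0`,
then `[E_n(ℚ) : φ_n(A_n(ℚ)) + E_n[2]] = 1`, i.e. `ρ(n) = 0`. No rank hypothesis.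
[cite: TianYuanZhang2017, §1, definition of ρ(n) (arXiv:1411.4728 chunk p0002 L101–L110)]
[cite: HeathBrown1994SelmerCongruentII, Appendix (Monsky), typescript p. 40 L40 – p. 41 L36]
[cite: SilvermanAEC2009, Prop. X.1.4, Prop. X.4.9] -/
theorem rhoIndex_eq_one_of_monskyKernel_even (hp : ∀ i, (p i).Prime) (hp2 : ∀ i, p i ≠ 2)
    (hinj : Function.Injective p)
    (hker : ∀ x y : Fin k → ZMod 2, monskyMatrixEven p *ᵥ Sum.elim x y = 0 → x = 0)
    {n : ℕ} (hn : 2 * ∏ i, p i = n) : (rhoSubgroup n).index = 1 := by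
  subst hn
  haveI := isElliptic_congruentNumberCurve (two_n_ne_zero hp)
  refine rhoIndex_eq_one_of_forall_inTorsionClasses (two_n_ne_zero hp) fun P => ?_
  exact inTorsionClasses_descentRep_of_selmer (two_n_ne_zero hp)
    (fun c hc b hb => inTorsionClasses_of_mem_selmer_even (splitTwoTorsion_cn _) hp hp2 hinj hker hc b hb) P

/-- **`s(n) = 1` version, even `n`.** If the kernel of Monsky's even matrix is `{0, v}` and the `β`-block of `v`
vanishes, then `ρ(n) = 0`. [cite: TianYuanZhang2017, §1, definition of ρ(n)]
[cite: HeathBrown1994SelmerCongruentII, Appendix (Monsky), typescript p. 41] -/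
theorem rhoIndex_eq_one_of_ker_pair_even (hp : ∀ i, (p i).Prime) (hp2 : ∀ i, p i ≠ 2)
    (hinj : Function.Injective p) (v : Fin k ⊕ Fin k → ZMod 2)
    (hker : ∀ w, monskyMatrixEven p *ᵥ w = 0 → w = 0 ∨ w = v) (hv : ∀ i, v (Sum.inl i) = 0)
    {n : ℕ} (hn : 2 * ∏ i, p i = n) : (rhoSubgroup n).index = 1 := by
  refine rhoIndex_eq_one_of_monskyKernel_even hp hp2 hinj (fun x y hxy => ?_) hn
  funext i
  rcases hker _ hxy with h | h
  · simpa using congrFun h (Sum.inl i)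
  · have := congrFun h (Sum.inl i)
    simp only [Sum.elim_inl] at this
    rw [this, hv i, Pi.zero_apply]

end Even

end RhoMonskyKernel

end Literature.NumberTheory.EllipticCurves.TianYuanZhang2017

end
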